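import Summits.ResolutionOfSingularities.ResolutionOfSingularities.Theses.ShadowGame

/-!
# Refutation of `ShadowGame.ShadowGameWin` (route ShadowGame, stmt-ResolutionOfSingularities-16159)

`ShadowGameWin` claims that for every prime `p` and every `n ≥ 1` the resolver A has a
shadow-measurable winning strategy in the `α_p`-torsor base-blow-up game `SG_p(n)`.  It is FALSE
already for `n = 2` (every `p`; formalised here at `p = 2`): nature B has a PERIOD-ONE winning play.

Witness (refuter seat refuter-rattack-stmt-ResolutionOfSingularities-16160-0, 2026-08-17).
Start series over `𝔽_p`:  `c₀ = x·((1 - x) y - x)^p = x y^p - x^{p+1} y^p - x^{p+1}`, support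
`{(1,p), (p+1,p), (p+1,0)}` — cleaned, non-zero, no exponent of total degree `≤ 1`, and the two
minimal exponents `(1,p)`, `(p+1,0)` are incomparable, so `c₀` is NOT terminal.  Moves:
* A plays the point `F = {x,y}`: B answers chart `x` and translation `τ_y = 1`; then
  `bl`: `(a,b) ↦ (a+b,b)`, `mF = p+1`, division by `x^p`, and the translation `y ↦ y+1` give back
  EXACTLY `c₀` (`x((1-x)(y+1) - 1)^p = x((1-x)y - x)^p`);
* A plays `F = {x}` or `F = {y}`: `mF = 1`, resp. `0`, so `s = 0` and the move is the identity.
Hence against ANY strategy the position never changes and never becomes terminal: B wins.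
Geometry: the torsor `z^p = x·w^p`, `w = (1-x)y - x` a regular parameter, is uniformized at once by
`z ↦ z/w` (`(z/w)^p = x`); B is the valuation following the smooth NON-COORDINATE curve `w = 0`,
which A's alphabet (coordinate-stratum centres, exceptional divisions, monomial cleaning, terminal
test in B's coordinates) can never straighten.  This is the route's own KILL CRITERION (ii) firing
at `n = 2`; an earlier period-6 witness at `(p,n) = (3,2)` (refuter-rreview-0816T17-5-0,
`c₀ = v²+u³v+u³v²`) was recorded as evidence on the item but not formalised.

Consequence for crux `WinToTorsorLU = ShadowGameWin → TorsorLUPerfect` (stmt-…-16160): it holds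
VACUOUSLY (`fun h => (ShadowGameShadowGameWin_refuted h).elim`), i.e. carries no content as stated.
-/

set_option linter.dupNamespace false -- mandated namespace `Summit.<S>.<S>.Theorems` of this single-conjunct summit

namespace Summit.ResolutionOfSingularities.ResolutionOfSingularities.Theorems

open Summit.ResolutionOfSingularities.ResolutionOfSingularities.Theses.ShadowGame

namespace ShadowGameWinRefutation

/-- The start position `x y² + x³ y² + x³ = x((1+x)y+x)²` over `𝔽₂`, as a coefficient function
on exponents `A = (A 0, A 1) = (deg_x, deg_y)`. [folklore] -/
def c0 : (Fin 2 → ℕ) → ZMod 2 := fun A =>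
  if (A 0 = 1 ∧ A 1 = 2) ∨ (A 0 = 3 ∧ A 1 = 2) ∨ (A 0 = 3 ∧ A 1 = 0) then 1 else 0

/-- The shadow of `c0` (it stays constant along B's play), spelled exactly as the statement's
`shadow c0` unfolds at `p = 2`, `κ = ZMod 2`. [folklore] -/
def S0 : Set (Fin 2 → ℚ) :=
  convexHull ℚ {x : Fin 2 → ℚ | ∃ A : Fin 2 → ℕ,
    (@ite (ZMod 2) (∀ j, 2 ∣ A j) (Classical.dec _) 0 (c0 A)) ≠ 0 ∧ ∀ j, ((A j : ℚ) / (2 : ℕ)) ≤ x j}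

/-- B's chart against a centre `F`: the `x`-chart whenever it is allowed. [folklore] -/
def sel (F : Finset (Fin 2)) : Fin 2 := if (0 : Fin 2) ∈ F then 0 else 1

/-- B's chart history after `m` rounds against the strategy `strat` (the shadow history is the
constant list `[S0, …, S0]`). [folklore] -/
def charts (strat : List (Set (Fin 2 → ℚ)) → List (Fin 2) → Finset (Fin 2)) : ℕ → List (Fin 2)
  | 0 => []
  | m + 1 => charts strat m ++ [sel (strat (List.replicate (m + 1) S0) (charts strat m))]

/-- B's chart sequence against `strat`. [folklore] -/
def chart (strat : List (Set (Fin 2 → ℚ)) → List (Fin 2) → Finset (Fin 2)) (m : ℕ) : Fin 2 :=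
  sel (strat (List.replicate (m + 1) S0) (charts strat m))

end ShadowGameWinRefutation

open ShadowGameWinRefutation in
/-- Refutes `ShadowGame.ShadowGameWin` [refuted-misstated]: B wins `SG_2(2)` with the period-one
play from `c₀ = x y² + x³ y² + x³ = x((1+x)y+x)²` over `𝔽₂` (chart `x`, translation `τ_y = 1`
whenever A blows up the point; A's singleton moves are identities), so no strategy of A — shadow
measurable or not — ever reaches a terminal position.  The witness torsor `z² = x·w²`,
`w = (1+x)y + x`, is uniformized by `z ↦ z/w`; B follows the non-coordinate regular curve `w = 0`.
Repaired statement C′ (planner's kill criterion (ii)): `ShadowGameWinR` = the same game with either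
(R1) `Terminal` taken up to a formal re-parametrisation `u_j ↦ u_j + φ(u_{others})` of the
non-exceptional coordinates and subtraction of `p`-th powers, or (R2) an extra A-move dividing along a
regular hypersurface of the base read from an enriched observable; this witness misses C′ under (R1)
(it is terminal′ at stage 0) — whether C′ is then an A-win for `n ≤ 3` is open (Spivakovsky 1982's
`n = 3` B-win must be re-examined). [folklore] -/
theorem ShadowGameShadowGameWin_refuted :
    ¬ Summit.ResolutionOfSingularities.ResolutionOfSingularities.Theses.ShadowGame.ShadowGameWin := by
  -- three small helpers, kept local (a refutation file carries a single theorem)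
  have sel_mem : ∀ F : Finset (Fin 2), F.Nonempty → sel F ∈ F := by
    intro F hF
    unfold sel
    split_ifs with h0
    · exact h0
    · obtain ⟨j, hj⟩ := hF
      fin_cases j
      · exact absurd hj h0
      · exact hj
  have cases_of_nonempty : ∀ F : Finset (Fin 2), F.Nonempty → F = {0} ∨ F = {1} ∨ F = {0, 1} := by
    intro F hF
    by_cases h0 : (0 : Fin 2) ∈ F <;> by_cases h1 : (1 : Fin 2) ∈ F
    · right; right; ext j; fin_cases j <;> simp [h0, h1]
    · left; ext j; fin_cases j <;> simp [h0, h1]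
    · right; left; ext j; fin_cases j <;> simp [h0, h1]
    · exfalso
      obtain ⟨j, hj⟩ := hF
      fin_cases j
      · exact h0 hj
      · exact h1 hj
  -- reindex a sum over the box `D : Fin 2 → ℕ`, `D j < N`, supported on `D 0 = 0`, by `d = D 1`
  have sum_piFinset_eq_sum_range : ∀ N : ℕ, 0 < N → ∀ F : (Fin 2 → ℕ) → ZMod 2,
      (∀ D, D 0 ≠ 0 → F D = 0) →
      Finset.sum (Fintype.piFinset fun _ : Fin 2 => Finset.range N) F =
        Finset.sum (Finset.range N) (fun d => F ![0, d]) := by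
    intro N hN F hF
    have key : ∀ D : Fin 2 → ℕ, D 0 = 0 → ![0, D 1] = D := fun D hD => by
      funext j; fin_cases j <;> simp [hD]
    rw [← Finset.sum_subset (Finset.filter_subset (fun D => D 0 = 0) _)
      (fun D _ hD => hF D (fun h0 => hD (Finset.mem_filter.2 ⟨‹_›, h0⟩)))]
    refine Finset.sum_nbij' (fun D => D 1) (fun d => ![0, d]) ?_ ?_ ?_ ?_ ?_
    · intro D hD
      simp only [Finset.mem_filter, Fintype.mem_piFinset] at hD
      exact hD.1 1
    · intro d hd
      simp only [Finset.mem_filter, Fintype.mem_piFinset, Finset.mem_range] at hd ⊢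
      exact ⟨fun a => by fin_cases a <;> simp [hN, hd], by simp⟩
    · intro D hD
      simp only [Finset.mem_filter] at hD
      exact key D hD.2
    · intro d _
      simp
    · intro D hD
      simp only [Finset.mem_filter] at hD
      rw [key D hD.2]
  intro h
  obtain ⟨strat, hne, hwin⟩ := h 2 Nat.prime_two 2 (by norm_num)
  have hw := hwin (ZMod 2) c0 (chart strat) (fun _ _ => 1)
  clear hwin h
  extract_lets clean bl mF dv tr step shadow Terminal play at hw
  -- (1) `c0` is clean
  have hclean : clean c0 = c0 := by
    funext A
    simp only [clean]
    split_ifs with hA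
    · have h0 := hA 0
      have h1 := hA 1
      have hc : ¬((A 0 = 1 ∧ A 1 = 2) ∨ (A 0 = 3 ∧ A 1 = 2) ∨ (A 0 = 3 ∧ A 1 = 0)) := by omega
      simp [c0, hc]
    · rfl
  -- (2) the shadow of `c0`
  have hshadow : shadow c0 = S0 := rfl
  -- (3) the orders `mF`
  have hmF01 : mF {0, 1} c0 = 3 := by
    simp only [mF]
    have hmem : (3 : ℕ) ∈ {m : ℕ | ∃ A, c0 A ≠ 0 ∧ m = Finset.sum ({0, 1} : Finset (Fin 2)) (fun j => A j)} := by
      refine ⟨![1, 2], by simp [c0], ?_⟩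
      rw [Finset.sum_pair (show (0 : Fin 2) ≠ 1 by decide)]
      simp
    refine le_antisymm (Nat.sInf_le hmem) (le_csInf ⟨3, hmem⟩ ?_)
    rintro m ⟨A, hA, rfl⟩
    have hA' : (A 0 = 1 ∧ A 1 = 2) ∨ (A 0 = 3 ∧ A 1 = 2) ∨ (A 0 = 3 ∧ A 1 = 0) := by
      by_contra hc
      exact hA (by simp [c0, hc])
    rw [Finset.sum_pair (show (0 : Fin 2) ≠ 1 by decide)]
    omega
  have hmF0 : 2 * (mF {0} c0 / 2) = 0 := by
    have : mF {0} c0 ≤ 1 := by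
      simp only [mF]
      exact Nat.sInf_le ⟨![1, 2], by simp [c0], by simp⟩
    omega
  have hmF1 : 2 * (mF {1} c0 / 2) = 0 := by
    have : mF {1} c0 ≤ 0 := by
      simp only [mF]
      exact Nat.sInf_le ⟨![3, 0], by simp [c0], by simp⟩
    omega
  -- (4) singleton moves are identities
  have hsingle : ∀ (i : Fin 2) (τ : Fin 2 → ZMod 2), 2 * (mF {i} c0 / 2) = 0 →
      step {i} i τ c0 = c0 := by
    intro i τ hs
    simp only [step]
    rw [hclean, hs]
    have hbl : bl {i} i c0 = c0 := by
      funext B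
      simp only [bl, Finset.erase_singleton, Finset.sum_empty, Nat.zero_le, Nat.sub_zero,
        Function.update_eq_self]
      rw [if_pos trivial]
    have hdv : dv i 0 c0 = c0 := by
      funext B
      simp only [dv, Nat.add_zero, Function.update_eq_self]
    have htr : tr {i} i τ 0 c0 = c0 := by
      funext B
      simp only [tr]
      rw [Finset.sum_eq_single (0 : Fin 2 → ℕ)]
      · rw [if_pos]
        · simp
        · intro j _
          rfl
      · intro D _ hD0
        rw [if_neg]
        intro hall
        exact hD0 (funext fun j => hall j (by simp [Finset.erase_singleton]))
      · intro h0
        exact absurd (Fintype.mem_piFinset.2 fun _ => by simp) h0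
    rw [hbl, hdv, htr, hclean]
  -- (5) the point blow-up followed by chart `x` and translation `τ_y = 1` fixes `c0`
  have herase : ({0, 1} : Finset (Fin 2)).erase 0 = {1} := by decide
  have hpair : ∀ τ : Fin 2 → ZMod 2, τ 1 = 1 → step {0, 1} 0 τ c0 = c0 := by
    intro τ hτ
    simp only [step]
    rw [hclean, hmF01, show 2 * (3 / 2) = 2 from rfl]
    -- closed form of the blown-up and divided series
    have hc' : ∀ E : Fin 2 → ℕ, dv 0 2 (bl {0, 1} 0 c0) E =
        if (E 0 = 1 ∧ E 1 = 2) ∨ (E 0 = 3 ∧ E 1 = 2) ∨ (E 0 = 1 ∧ E 1 = 0) then 1 else 0 := by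
      intro E
      simp only [dv, bl, herase, Finset.sum_singleton, Function.update_self,
        c0, Function.update_of_ne (show (1 : Fin 2) ≠ 0 by decide)]
      split_ifs <;> first | rfl | (exfalso; omega)
    -- the translated series, coefficient by coefficient
    have htr : ∀ B : Fin 2 → ℕ, tr {0, 1} 0 τ 2 (dv 0 2 (bl {0, 1} 0 c0)) B = c0 B := by
      intro B
      simp only [tr]
      rw [sum_piFinset_eq_sum_range (B 0 + 2 + 1) (by omega)]
      · simp only [herase, Finset.mem_singleton, Fin.forall_fin_two, Matrix.cons_val_zero,
          Matrix.cons_val_one, implies_true, not_true_eq_false, false_implies, and_true, if_true,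
          hc', Finset.prod_singleton, Pi.add_apply, add_zero, hτ, one_pow, mul_one]
        rw [← Finset.sum_subset (Finset.range_subset_range.2 (show 3 ≤ B 0 + 2 + 1 by omega))]
        · simp only [c0]
          generalize B 0 = a
          generalize B 1 = b
          rcases Nat.lt_or_ge b 3 with hb | hb
          · simp only [Finset.sum_range_succ, Finset.sum_range_zero, zero_add]
            have ha : a = 1 ∨ a = 3 ∨ (a ≠ 1 ∧ a ≠ 3) := by omega
            interval_cases b <;> rcases ha with rfl | rfl | ⟨_, _⟩ <;> first | decide | simp_all
          · rw [Finset.sum_eq_zero]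
            · rw [if_neg]
              omega
            · intro d hd
              rw [Finset.mem_range] at hd
              rw [if_neg, zero_mul]
              omega
        · intro d _ hd
          rw [Finset.mem_range, not_lt] at hd
          rw [if_neg, zero_mul]
          omega
      · intro D hD
        rw [if_neg]
        intro hall
        exact hD (hall 0 (by decide))
    rw [show tr {0, 1} 0 τ 2 (dv 0 2 (bl {0, 1} 0 c0)) = c0 from funext htr, hclean]
  -- (6) every legal move of A fixes `c0`
  have hstepF : ∀ F : Finset (Fin 2), F.Nonempty → step F (sel F) (fun _ => 1) c0 = c0 := by
    intro F hF
    rcases cases_of_nonempty F hF with rfl | rfl | rfl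
    · rw [show sel {0} = 0 from by decide]
      exact hsingle 0 _ hmF0
    · rw [show sel {1} = 1 from by decide]
      exact hsingle 1 _ hmF1
    · rw [show sel {0, 1} = 0 from by decide]
      exact hpair _ rfl
  -- (7) `c0` is not terminal
  have hterm : ¬ Terminal c0 := by
    simp only [Terminal]
    rw [hclean]
    rintro (hall | ⟨A, hA, hcase⟩)
    · exact absurd (hall ![1, 2]) (by simp [c0])
    · have hA' : (A 0 = 1 ∧ A 1 = 2) ∨ (A 0 = 3 ∧ A 1 = 2) ∨ (A 0 = 3 ∧ A 1 = 0) := by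
        by_contra hc
        exact hA (by simp [c0, hc])
      rcases hcase with hsum | hmin
      · rw [Fin.sum_univ_two] at hsum
        omega
      · rcases hA' with ⟨_, h1⟩ | ⟨h0, _⟩ | ⟨h0, _⟩
        · have := hmin ![3, 0] (by simp [c0]) 1
          simp at this
          omega
        · have := hmin ![1, 2] (by simp [c0]) 0
          simp at this
          omega
        · have := hmin ![1, 2] (by simp [c0]) 0
          simp at this
          omega
  -- (8) the play is constant
  have hplay : ∀ m, play m = (c0, List.replicate (m + 1) S0, charts strat m) := by
    intro m
    induction m with
    | zero =>
      simp only [play]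
      rfl
    | succ m ih =>
      simp only [play] at ih ⊢
      rw [ih]
      have hs : step (strat (List.replicate (m + 1) S0) (charts strat m)) (chart strat m)
          (fun _ => 1) c0 = c0 := hstepF _ (hne _ _)
      simp only [hs, hshadow]
      simp only [charts, chart, List.replicate_succ']
  -- (9) B's play is legal, hence should terminate — but it never does
  obtain ⟨m, hm⟩ := hw (fun m => by
    rw [hplay]
    exact sel_mem _ (hne _ _))
  rw [hplay] at hm
  exact hterm hm

/-- Corollary: the crux `WinToTorsorLU = ShadowGameWin → TorsorLUPerfect` (stmt-…-16160) holds
vacuously; recorded as an `example` only (a positive Theses statement is a prover's landing). -/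
example : Summit.ResolutionOfSingularities.ResolutionOfSingularities.Theses.ShadowGame.WinToTorsorLU :=
  fun h => (ShadowGameShadowGameWin_refuted h).elim

end Summit.ResolutionOfSingularities.ResolutionOfSingularities.Theorems
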